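import Mathlib

/-!
# Finite-range matrices: light-cone support of powers and window exactness (DEQ-A16)

HONEST FRAMING: instance-level adjudication of specific advantage claims; no claim about
BQP vs BPP or the summit.

Context (cell pub-qadeq, claim A-16 = Simon–Berry–Somma, arXiv:2605.16195v1 (2026),
"Efficient quantum algorithm for linear matrix differential equations and applications to
open quantum systems", §V and App. D: for instances on a lattice in `D` dimensions the
classical cost of one entry `⟨j|X(t)|k⟩` of the solution of `dX/dt = A†X + XB + C` is argued
to be `Ω((a tₑ)^{1+D})` for Krylov-type methods, against `Õ(a tₑ/ε)` quantum queries, and a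
"quartic speedup for `D = 3`" is stated).  DEQ-A16.md (unit pub-qadeq-deq-1) proves the
matching classical UPPER bound (Theorem A16 there: a windowed light-cone algorithm using
`Õ((a tₑ)^{1+D} · polylog(1/ε))` operations and `Õ((a tₑ)^{D})` memory for finite-range
sparse `A, B, C, X(0)`).  Its load-bearing locality fact is elementary and is proved here,
sorry-free, for square matrices over an arbitrary semiring and an arbitrary "distance"
`d : ι → ι → ℕ` with `d i i = 0` and the triangle inequality:

* `pow_apply_eq_zero` : if `M i j = 0` whenever `R < d i j` (`M` has range `R`), then
  `(M ^ m) i j = 0` whenever `m * R < d i j`: the `k`-th column of `M ^ m` is supported on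
  the ball of radius `m * R` around `k`.  In print: Sakamoto–Fujii, "On the quantum
  computational complexity of classical linear dynamics with geometrically local
  interactions: Dequantization and universality", Quantum 10, 2182 (2026) = arXiv:2505.10445v4,
  Lemma 1, eq. (13) ("`(A^k)_{ij} = 0` for `d(i,j) > k r₀`"), whose Theorem 1 is the
  sampling-based dequantization of eigenvalue transforms of geometrically local matrices
  (cost `O(log(1/δ)(d² N(d r₀) N(r₀) q(A) + …)/ε²)`); cf. also Stroeks–Lenterman–Terhal–
  Herasymenko, arXiv:2409.04550 = Phys. Rev. Research 7, 043176 (2025), App. 8 ("`h^k` has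
  support on `O(k^d)` states").
* `restrict_pow_apply` : if the window `W` contains the ball `{i | d i k ≤ m * R}`, then the
  windowed matrix `restrict W M` (entries outside `W × W` replaced by `0`) satisfies
  `((restrict W M) ^ m) i k = (M ^ m) i k` for EVERY row index `i`: powers up to `m` of the
  `|W| × |W|` window reproduce the `k`-th column of the powers of the full matrix exactly.
  This is what lets the classical algorithm of DEQ-A16 replace `N × N` matrices by window
  matrices of light-cone size at the price of a Taylor-tail error only (DEQ-A16.md §2,
  Lemma 1; the tail estimate, Lemma 2 there, is real analysis and is not formalised here).
* `restrict_pow_mulVec_single` : the same statement for the vector `(M ^ m) eₖ`.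

Everything is `[folklore]`-level finite algebra; no named fact, no axiom.
-/

namespace Literature.Computability.QuantumAlgorithms.FiniteRangeLightCone

open Finset BigOperators Matrix

variable {ι : Type*} [Fintype ι] [DecidableEq ι] {α : Type*} [Semiring α]

/-- `[folklore]` `M` has range `R` with respect to the distance `d`: the entry `M i j`
vanishes whenever `d i j > R` (a banded / geometrically local / finite-range matrix). -/
def IsFiniteRange (d : ι → ι → ℕ) (R : ℕ) (M : Matrix ι ι α) : Prop :=
  ∀ i j, R < d i j → M i j = 0

/-- `[folklore]` the window restriction of `M` to `W`: entries outside `W × W` are set to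
zero (as an `ι × ι` matrix; it acts as the `|W| × |W|` principal submatrix padded by zeros). -/
def restrict (W : Finset ι) (M : Matrix ι ι α) : Matrix ι ι α :=
  fun i j => if i ∈ W ∧ j ∈ W then M i j else 0

omit [Fintype ι] in
/-- `[folklore]` a restricted matrix has range `R` whenever `M` has (bookkeeping for
DEQ-A16 Lemma 1). -/
theorem isFiniteRange_restrict {d : ι → ι → ℕ} {R : ℕ} {M : Matrix ι ι α}
    (hM : IsFiniteRange d R M) (W : Finset ι) : IsFiniteRange d R (restrict W M) := by
  intro i j hij
  unfold restrict
  by_cases h : i ∈ W ∧ j ∈ W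
  · rw [if_pos h]; exact hM i j hij
  · rw [if_neg h]

/-- `[folklore]` light-cone support of powers (DEQ-A16.md §2 Lemma 1(a)): if `M` has range
`R` for a distance `d` with `d i i = 0` and the triangle inequality, then `(M ^ m) i j = 0`
whenever `m * R < d i j`.  In print as Sakamoto–Fujii, Quantum 10, 2182 (2026) =
arXiv:2505.10445v4, Lemma 1 (eq. (13)); cf. Stroeks et al., arXiv:2409.04550 App. 8. -/
theorem pow_apply_eq_zero {d : ι → ι → ℕ} (hrefl : ∀ i, d i i = 0)
    (htri : ∀ i j l, d i l ≤ d i j + d j l) {R : ℕ} {M : Matrix ι ι α}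
    (hM : IsFiniteRange d R M) :
    ∀ (m : ℕ) (i j : ι), m * R < d i j → (M ^ m) i j = 0 := by
  intro m
  induction m with
  | zero =>
    intro i j h
    have hij : i ≠ j := by
      intro hc; subst hc; rw [hrefl i] at h; simp at h
    rw [pow_zero, Matrix.one_apply_ne hij]
  | succ m ih =>
    intro i j h
    rw [pow_succ, Matrix.mul_apply]
    apply Finset.sum_eq_zero
    intro l _
    by_cases h1 : m * R < d i l
    · rw [ih i l h1, zero_mul]
    · by_cases h2 : R < d l j
      · rw [hM l j h2, mul_zero]
      · exfalso
        push Not at h1 h2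
        rw [add_mul, one_mul] at h
        have h3 := htri i l j
        omega

/-- `[folklore]` contrapositive form: a non-zero entry `(M ^ m) i j` forces `d i j ≤ m * R`. -/
theorem dist_le_of_pow_apply_ne_zero {d : ι → ι → ℕ} (hrefl : ∀ i, d i i = 0)
    (htri : ∀ i j l, d i l ≤ d i j + d j l) {R : ℕ} {M : Matrix ι ι α}
    (hM : IsFiniteRange d R M) {m : ℕ} {i j : ι} (h : (M ^ m) i j ≠ 0) : d i j ≤ m * R := by
  by_contra hc
  push Not at hc
  exact h (pow_apply_eq_zero hrefl htri hM m i j hc)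

/-- `[folklore]` window exactness (DEQ-A16.md §2 Lemma 1(b)): if the window `W` contains
every index within distance `m * R` of `k`, then for every row index `i` the `(i,k)` entry of
the `m`-th power of the windowed matrix equals that of the full matrix.  Hence the vectors
`(restrict W M)^p eₖ`, `p ≤ m`, computed inside the window, ARE the vectors `M^p eₖ`. -/
theorem restrict_pow_apply {d : ι → ι → ℕ} (hrefl : ∀ i, d i i = 0)
    (htri : ∀ i j l, d i l ≤ d i j + d j l) {R : ℕ} {M : Matrix ι ι α}
    (hM : IsFiniteRange d R M) (W : Finset ι) (k : ι) :
    ∀ (m : ℕ), (∀ i, d i k ≤ m * R → i ∈ W) →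
      ∀ i, ((restrict W M) ^ m) i k = (M ^ m) i k := by
  intro m
  induction m with
  | zero =>
    intro _ i
    rw [pow_zero, pow_zero]
  | succ m ih =>
    intro hW i
    have hmono : m * R ≤ (m + 1) * R := Nat.mul_le_mul_right R (Nat.le_succ m)
    have hW' : ∀ i, d i k ≤ m * R → i ∈ W := fun i hi => hW i (le_trans hi hmono)
    by_cases hi : i ∈ W
    · rw [pow_succ', pow_succ', Matrix.mul_apply, Matrix.mul_apply]
      apply Finset.sum_congr rfl
      intro l _
      rw [ih hW' l]
      by_cases hl : l ∈ W
      · simp only [restrict, hi, hl, and_self, if_true]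
      · have hlk : m * R < d l k := by
          by_contra hc
          push Not at hc
          exact hl (hW' l hc)
        rw [pow_apply_eq_zero hrefl htri hM m l k hlk, mul_zero, mul_zero]
    · have hik : (m + 1) * R < d i k := by
        by_contra hc
        push Not at hc
        exact hi (hW i hc)
      have hfull : (M ^ (m + 1)) i k = 0 := pow_apply_eq_zero hrefl htri hM (m + 1) i k hik
      rw [hfull, pow_succ', Matrix.mul_apply]
      apply Finset.sum_eq_zero
      intro l _
      simp only [restrict, hi, false_and, if_false, zero_mul]

/-- `[folklore]` vector form of window exactness: inside a window containing the ball of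
radius `m * R` around `k`, the windowed power applied to the basis vector `eₖ` is the full
power applied to `eₖ` (the statement used verbatim by the Taylor-stepping classical
algorithm of DEQ-A16, which only ever forms such vectors). -/
theorem restrict_pow_mulVec_single {d : ι → ι → ℕ} (hrefl : ∀ i, d i i = 0)
    (htri : ∀ i j l, d i l ≤ d i j + d j l) {R : ℕ} {M : Matrix ι ι α}
    (hM : IsFiniteRange d R M) (W : Finset ι) (k : ι) (m : ℕ)
    (hW : ∀ i, d i k ≤ m * R → i ∈ W) :
    ((restrict W M) ^ m).mulVec (Pi.single k 1) = (M ^ m).mulVec (Pi.single k 1) := by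
  ext i
  simp only [Matrix.mulVec, dotProduct, Pi.single_apply, mul_ite, mul_one, mul_zero,
    Finset.sum_ite_eq', Finset.mem_univ, if_true]
  exact restrict_pow_apply hrefl htri hM W k m hW i

end Literature.Computability.QuantumAlgorithms.FiniteRangeLightCone
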